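import Summits.Ventures.HSemireg.WedgeBoxDegreeN

/-!
# Venture HSemireg — THEOREM K∘T for the box (5/8)

HONEST FRAMING. Part of the Lean index of the computation cell `pub-hsemireg` (seat p3; Sunday enclosure of the
FORMULA-N kernel assets of seats th-7 / th-6, ENCLOSURE-PLAN-p3.md).  Finite-dimensional exterior algebra over a field ONLY:
no variety, no cohomology theory, no semiregularity map is constructed here; nothing here says that HC / HC_CM / HC_AV holds;
no Literature fact is declared or used.  The geometric DICTIONARY (why these ranks are the `HT`-side box ranks of the cell's
STRUCTURE.md §1 / theory/FORMULA-N.md) lives in theory/FORMULA-N-th7.md PART B §A.3 / §N and is NOT asserted in Lean.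

THEOREM K∘T for the BOX of two point pairs (FORMULA-N PART A §2.3 / PART B §L; th-7 theory/th7/BoxRank.lean v4 sha256/16
88aeb4a1de514ae6, l.1177–1360), file 5 of 8 — generators `I n := Fin (4n)` in four blocks `A 0 = X`, `A 1 = Y` (factor 1), `C 0 = X′`,
`C 1 = Y′` (factor 2); the coefficient-matrix box `boxClass c := Σ_{α,β} c α β • E_{A α ∪ C β}` and the HONEST box `fac1 a * fac2 a′`;
ranks of `θ ↦ θ ∧ box` on `⋀^k` in every degree: `4C(2n,k) − 4C(n,k)` (0 < k < n), the degree-n PURITY DROP `4C(2n,n) − 6` on the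
decomposable locus, `4C(2n,k) − 4C(n,k−n)` (n < k < 2n), `1` in degrees 0 and 2n; one citable form `finrank_range_wedgeMap_fac_mul_all`
(file 8).  No permutation sign is ever evaluated.  th-7's statements and proofs, unchanged (namespace `HSemiregBox` ↦
`Summit.Ventures.HSemireg.WedgeBox`; this family's Fin-indexed `B K n s` is its own, kept apart from `Wedge.B` / `WedgePair.B` by namespace).
Part III/1 (degrees n < k < 2n): `pcOf`, pairing lemmas, mixed monomials in high degree, `Jk`.
-/

open Module Set Set.powersetCard

namespace Summit.Ventures.HSemireg.WedgeBox

variable (K : Type*) [Field K] {n : ℕ}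

/-! ### Degrees `n < k < 2n`: monomials containing a whole block pair up; `rank + 4·C(n,k−n) = 4·C(2n,k)`
(= `R_k(n) = [t^k]P_n²` in the upper range; with Part I and the degree-`n` theorem this is THEOREM K∘T for
the honest box in every degree `0 < k < 2n`). -/

section DegreeHigh

variable {k : ℕ}

/-- a Finset as an element of `powersetCard` of its own cardinality. -/
def pcOf (R : Finset (I n)) : powersetCard (I n) R.card := ⟨R, by rw [mem_iff]⟩

/-- coercion of `pcOf R` is `R`. -/
@[simp] lemma coe_pcOf (R : Finset (I n)) : ((pcOf R : powersetCard (I n) R.card) : Finset (I n)) = R := rfl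

/-- structure constant of `R` with a disjoint factor-1 block is non-zero. -/
lemma sgn_pcOf_A_ne_zero {R : Finset (I n)} {γ : Fin 2} (hR : Disjoint R (A n γ)) :
    sgn K (pcOf R) (Apc n γ) ≠ 0 := (sgn_ne_zero_iff K).mpr hR

/-- structure constant of `R` with a disjoint factor-2 block is non-zero. -/
lemma sgn_pcOf_C_ne_zero {R : Finset (I n)} {δ : Fin 2} (hR : Disjoint R (C n δ)) :
    sgn K (pcOf R) (Cpc n δ) ≠ 0 := (sgn_ne_zero_iff K).mpr hR

/-- `E_{A_γ ∪ R} = sgn(R, A_γ)⁻¹ • (E_R ∧ E_{A_γ})` for `R` disjoint from `A_γ`. -/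
lemma B_A_union (R : Finset (I n)) (γ : Fin 2) (hR : Disjoint R (A n γ)) :
    (B K n) (A n γ ∪ R) = (sgn K (pcOf R) (Apc n γ))⁻¹ •
      (B K n (pcOf R : powersetCard (I n) R.card) * B K n (Apc n γ : powersetCard (I n) n)) := by
  rw [B_mul_B, smul_smul, inv_mul_cancel₀ (sgn_pcOf_A_ne_zero K hR), one_smul, coe_pcOf, coe_Apc,
    Finset.union_comm]

/-- `E_{R ∪ C_δ} = sgn(R, C_δ)⁻¹ • (E_R ∧ E_{C_δ})` for `R` disjoint from `C_δ`. -/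
lemma B_union_C (R : Finset (I n)) (δ : Fin 2) (hR : Disjoint R (C n δ)) :
    (B K n) (R ∪ C n δ) = (sgn K (pcOf R) (Cpc n δ))⁻¹ •
      (B K n (pcOf R : powersetCard (I n) R.card) * B K n (Cpc n δ : powersetCard (I n) n)) := by
  rw [B_mul_B, smul_smul, inv_mul_cancel₀ (sgn_pcOf_C_ne_zero K hR), one_smul, coe_pcOf, coe_Cpc]

/-- A-side pairing: `E_{A1 ∪ R} ∧ v` is a multiple of `E_{A0 ∪ R} ∧ v`. -/
lemma B_A1_union_mul (hn : 0 < n) {a a' : Fin 2 → K} (ha : ∀ α, a α ≠ 0) (R : Finset (I n))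
    (h0 : Disjoint R (A n 0)) (h1 : Disjoint R (A n 1)) :
    (B K n) (A n 1 ∪ R) * (fac1 K n a * fac2 K n a') =
      ((sgn K (pcOf R) (Apc n 1))⁻¹ * (a 0 * (-1 : K) ^ (n * n) * (a 1)⁻¹) * sgn K (pcOf R) (Apc n 0)) •
        ((B K n) (A n 0 ∪ R) * (fac1 K n a * fac2 K n a')) := by
  have hW1 : (B K n) (A n 1 ∪ R) * (fac1 K n a * fac2 K n a') =
      ((sgn K (pcOf R) (Apc n 1))⁻¹ * (a 0 * (-1 : K) ^ (n * n) * (a 1)⁻¹)) •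
        (B K n (pcOf R : powersetCard (I n) R.card) *
          (B K n (Apc n 0 : powersetCard (I n) n) * (fac1 K n a * fac2 K n a'))) := by
    rw [B_A_union K R 1 h1, smul_mul_assoc, mul_assoc, vecA1_eq_smul_vecA0 K hn a a' ha, mul_smul_comm,
      smul_smul]
  have hW0 : (B K n) (A n 0 ∪ R) * (fac1 K n a * fac2 K n a') =
      (sgn K (pcOf R) (Apc n 0))⁻¹ •
        (B K n (pcOf R : powersetCard (I n) R.card) *
          (B K n (Apc n 0 : powersetCard (I n) n) * (fac1 K n a * fac2 K n a'))) := by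
    rw [B_A_union K R 0 h0, smul_mul_assoc, mul_assoc]
  rw [hW1, hW0, smul_smul, mul_inv_cancel_right₀ (sgn_pcOf_A_ne_zero K h0)]

/-- C-side pairing: `E_{R ∪ C1} ∧ v` is a multiple of `E_{R ∪ C0} ∧ v`. -/
lemma B_union_C1_mul (hn : 0 < n) {a a' : Fin 2 → K} (ha' : ∀ β, a' β ≠ 0) (R : Finset (I n))
    (h0 : Disjoint R (C n 0)) (h1 : Disjoint R (C n 1)) :
    (B K n) (R ∪ C n 1) * (fac1 K n a * fac2 K n a') =
      ((sgn K (pcOf R) (Cpc n 1))⁻¹ * (a' 0 * (-1 : K) ^ (n * n) * (a' 1)⁻¹) * sgn K (pcOf R) (Cpc n 0)) •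
        ((B K n) (R ∪ C n 0) * (fac1 K n a * fac2 K n a')) := by
  have hW1 : (B K n) (R ∪ C n 1) * (fac1 K n a * fac2 K n a') =
      ((sgn K (pcOf R) (Cpc n 1))⁻¹ * (a' 0 * (-1 : K) ^ (n * n) * (a' 1)⁻¹)) •
        (B K n (pcOf R : powersetCard (I n) R.card) *
          (B K n (Cpc n 0 : powersetCard (I n) n) * (fac1 K n a * fac2 K n a'))) := by
    rw [B_union_C K R 1 h1, smul_mul_assoc, mul_assoc, vecC1_eq_smul_vecC0 K hn a a' ha', mul_smul_comm,
      smul_smul]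
  have hW0 : (B K n) (R ∪ C n 0) * (fac1 K n a * fac2 K n a') =
      (sgn K (pcOf R) (Cpc n 0))⁻¹ •
        (B K n (pcOf R : powersetCard (I n) R.card) *
          (B K n (Cpc n 0 : powersetCard (I n) n) * (fac1 K n a * fac2 K n a'))) := by
    rw [B_union_C K R 0 h0, smul_mul_assoc, mul_assoc]
  rw [hW1, hW0, smul_smul, mul_inv_cancel_right₀ (sgn_pcOf_C_ne_zero K h0)]

/-! #### Above degree `n` every relevant monomial is mixed; canonical pair of a mixed monomial. -/

/-- in degrees `k > n` every relevant monomial is mixed. -/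
lemma mem_Mix_of_Rel_high (hnk : n < k) {s : Finset (I n)} (hs : s ∈ Rel n k) :
    ∃ p, s ∈ Mix n k p := by
  rcases mem_Rel.mp hs with ⟨p, h⟩ | ⟨α, h⟩ | ⟨β, h⟩
  · exact ⟨p, h⟩
  · exfalso
    have h' := Finset.card_le_card (mem_PureA.mp h).1
    have h1 := (mem_PureA.mp h).2
    have h2 := card_A n α
    omega
  · exfalso
    have h' := Finset.card_le_card (mem_PureC.mp h).1
    have h1 := (mem_PureC.mp h).2
    have h2 := card_C n β
    omega

/-- the chosen factor-1 block of a mixed monomial of pair `p` is `other p.1`. -/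
lemma αc_of_mem_Mix {p : Fin 2 × Fin 2} {s : Finset (I n)} (hs : s ∈ Mix n k p) : αc s = other p.1 := by
  obtain ⟨i, hi, hiA⟩ := exists_mem_A_of_mem_Mix hs
  have hsub := (mem_Mix.mp hs).1
  have hdis := disjoint_A_of_subset_P hsub
  unfold αc
  by_cases h0 : p.1 = 0
  · rw [h0] at hiA
    rw [if_neg (fun hd => Finset.disjoint_left.mp hd hi hiA), h0, other_zero]
  · have h1 : p.1 = 1 := by omega
    rw [h1, other_one] at hdis
    rw [if_pos hdis, h1, other_one]

/-- the chosen factor-2 block of a mixed monomial of pair `p` is `other p.2`. -/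
lemma βc_of_mem_Mix {p : Fin 2 × Fin 2} {s : Finset (I n)} (hs : s ∈ Mix n k p) : βc s = other p.2 := by
  obtain ⟨i, hi, hiC⟩ := exists_mem_C_of_mem_Mix hs
  have hsub := (mem_Mix.mp hs).1
  have hdis := disjoint_C_of_subset_P hsub
  unfold βc
  by_cases h0 : p.2 = 0
  · rw [h0] at hiC
    rw [if_neg (fun hd => Finset.disjoint_left.mp hd hi hiC), h0, other_zero]
  · have h1 : p.2 = 1 := by omega
    rw [h1, other_one] at hdis
    rw [if_pos hdis, h1, other_one]

/-! #### The reduced index set `Jk = Rel ∖ {s ⊇ A1} ∖ {s ⊇ C1}` and its KEY lemma. -/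

variable (n k)

/-- relevant degree-`k` monomials not containing the whole block `A 1` or `C 1`. -/
noncomputable def Jk : Finset (Finset (I n)) :=
  (Rel n k).filter fun s => ¬ A n 1 ⊆ s ∧ ¬ C n 1 ⊆ s

variable {n k}

/-- membership in `Jk`: relevant of degree `k`, containing neither `A 1` nor `C 1`. -/
lemma mem_Jk {s : Finset (I n)} : s ∈ Jk n k ↔ s ∈ Rel n k ∧ ¬ A n 1 ⊆ s ∧ ¬ C n 1 ⊆ s := by
  rw [Jk, Finset.mem_filter]

/-- KEY above degree `n`, on `Jk`. -/
lemma key_high (hn : 0 < n) (hnk : n < k) {s s' : Finset (I n)} {α' β' : Fin 2}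
    (hs : s ∈ Jk n k) (hs' : s' ∈ Jk n k)
    (hd' : Disjoint s' (P n α' β')) (h : s' ∪ P n α' β' = s ∪ P n (αc s) (βc s)) :
    α' = αc s ∧ β' = βc s ∧ s' = s := by
  obtain ⟨hsRel, hsA1, hsC1⟩ := mem_Jk.mp hs
  obtain ⟨hs'Rel, hs'A1, hs'C1⟩ := mem_Jk.mp hs'
  obtain ⟨⟨γ, δ⟩, hsMix⟩ := mem_Mix_of_Rel_high hnk hsRel
  have hsub : s ⊆ P n γ δ := (mem_Mix.mp hsMix).1
  have hαc : αc s = other γ := αc_of_mem_Mix hsMix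
  have hβc : βc s = other δ := βc_of_mem_Mix hsMix
  have hd : Disjoint s (P n (αc s) (βc s)) := disjoint_P_canonical hsRel
  have hs'eq : s' = (s ∪ P n (αc s) (βc s)) \ P n α' β' := by
    rw [← h, Finset.union_sdiff_cancel_right hd']
  -- a set inside the canonical pair support and disjoint from `P α' β'` lies in `s'`
  have hIn : ∀ T : Finset (I n), T ⊆ P n (αc s) (βc s) → Disjoint T (P n α' β') → T ⊆ s' := by
    intro T hT hTd i hi
    rw [hs'eq, Finset.mem_sdiff]
    exact ⟨Finset.mem_union_right _ (hT hi), fun hi' => Finset.disjoint_left.mp hTd hi hi'⟩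
  by_cases hα : α' = αc s
  · by_cases hβ : β' = βc s
    · subst hα hβ
      exact ⟨rfl, rfl, by rw [hs'eq, Finset.union_sdiff_cancel_right hd]⟩
    · exfalso
      have hCs : C n β' ⊆ s := by
        apply C_subset_of_subset_union hβ
        rw [← h]; intro i hi; exact Finset.mem_union_right _ (by rw [P]; exact Finset.mem_union_right _ hi)
      have hβδ : β' = δ := by
        obtain ⟨i, hi⟩ : (C n β').Nonempty := by rw [← Finset.card_pos, card_C]; exact hn
        exact (eq_of_mem_C_of_mem_P hi (hsub (hCs hi))).symm
      have hδ0 : δ = 0 := by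
        by_contra hne
        apply hsC1
        rw [show (1 : Fin 2) = β' by omega]
        exact hCs
      apply hs'C1
      apply hIn
      · rw [hβc, hδ0, other_zero, P]; exact Finset.subset_union_right
      · rw [hβδ, hδ0, disjoint_P_iff]
        exact ⟨(disjoint_A_C n α' 1).symm, disjoint_C_C n (by decide)⟩
  · exfalso
    have hAs : A n α' ⊆ s := by
      apply A_subset_of_subset_union hα
      rw [← h]; intro i hi; exact Finset.mem_union_right _ (by rw [P]; exact Finset.mem_union_left _ hi)
    have hαγ : α' = γ := by
      obtain ⟨i, hi⟩ : (A n α').Nonempty := by rw [← Finset.card_pos, card_A]; exact hn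
      exact (eq_of_mem_A_of_mem_P hi (hsub (hAs hi))).symm
    have hγ0 : γ = 0 := by
      by_contra hne
      apply hsA1
      rw [show (1 : Fin 2) = α' by omega]
      exact hAs
    apply hs'A1
    apply hIn
    · rw [hαc, hγ0, other_zero, P]; exact Finset.subset_union_left
    · rw [hαγ, hγ0, disjoint_P_iff]
      exact ⟨disjoint_A_A n (by decide), disjoint_A_C n 1 β'⟩

/-! #### Linear independence on `Jk`. -/

end DegreeHigh

end Summit.Ventures.HSemireg.WedgeBox
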